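import Literature.AlgebraicGeometry.Resolution.RankOneReductionProofs
import Literature.AlgebraicGeometry.Resolution.AffineDomainDimension
import HarnessLib

/-!
# Novacoski–Spivakovsky's reduction to rank one, in bounded transcendence degree

Topic: `Literature/AlgebraicGeometry/Resolution` (proofs only; no new notions, no new named
facts). `RankOneReductionProofs.lean` proves Novacoski–Spivakovsky's Thm. 1.1
(`NovacoskiSpivakovsky2014_holds`): if every RANK-ONE valuation ring of every field `K ⊇ k`
admits relative local uniformization (`RelLocalUniformization k K O`), so does every valuation
ring. As typed, the hypothesis runs over function fields of EVERY transcendence degree, so the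
theorem cannot be fed with a local-uniformization theorem available in bounded dimension only
(Cossart–Piltant 2019 in dimension three). The printed induction (§3.1) never leaves the
fields of transcendence degree `≤ tr.deg_k K`: it passes from `(K, ν)` to `(K, ν₁)` and to the
restrictions of `ν₂` to subfields `κ = Frac Φ(A₁)` of the residue field of `ν₁`, and
`tr.deg_k κ ≤ tr.deg_k A₁ = tr.deg_k K` (`Φ(A₁)` is a quotient of the affine model `A₁`). This
file records that observation as a theorem:

* `relLocalUniformization_of_rankOne_of_trdeg_le` — for a field `k` and `d : ℕ`: if
  `RelLocalUniformization k K O` holds for every field `K ⊇ k` with `tr.deg_k K ≤ d` and every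
  rank-one valuation ring `O` of `K`, then it holds for every valuation ring of every such `K`.

The proof is the induction of `NovacoskiSpivakovsky2014_holds` verbatim (Cor. 2.14
`novacoskiSpivakovsky2014_cor214`, Cor. 2.17 `novacoskiSpivakovsky2014_cor217`, the final step
`novacoskiSpivakovsky2014_step`, finiteness of the rank `finite_overrings_of_fg`), with the bound
`Algebra.trdeg k K ≤ d` threaded through (Mathlib's `trdeg_le_of_surjective` for
`A₁ ↠ Φ(A₁)` and `trdeg_eq_trdeg_of_isFractionRing` for `Frac`). Used by the rank-one form of
Cossart–Piltant's descent (journal Prop. 4.8: "To begin with, we may assume that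
`dim 𝒪_v = 1`, applying [NSp] theorem 1.1").

## Sources

* J. Novacoski, M. Spivakovsky, *Reduction of local uniformization to the rank one case*,
  Valuation Theory in Interaction, EMS Ser. Congr. Rep. (2014) 404–431 = arXiv:1204.4751v1,
  Thm. 1.1 and §3.1. [NovacoskiSpivakovsky2014]
* V. Cossart, O. Piltant, J. Algebra 529 (2019) 268–535 = arXiv:1412.0868, proof of Prop. 4.8
  (arXiv v1: Prop. 4.6, p. 53). [CossartPiltant2019]
-/

noncomputable section

open IsLocalRing

namespace Literature.AlgebraicGeometry.Resolution

/-- **Novacoski–Spivakovsky 2014, Thm. 1.1, in transcendence degree `≤ d`**: for a field `k` and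
`d : ℕ`, if every rank-one valuation ring `O` of every field `K ⊇ k` with `tr.deg_k K ≤ d`
satisfies `RelLocalUniformization k K O`, then so does every valuation ring of every such field.
Novacoski–Spivakovsky's induction on the rank (§3.1) stays inside this class of fields: `ν₁`
lives on the same `K`, and the restrictions of `ν₂` live on subfields `κ = Frac Φ(A₁)` of the
residue field of `ν₁` with `tr.deg_k κ = tr.deg_k Φ(A₁) ≤ tr.deg_k A₁ = tr.deg_k K`.
[cite: NovacoskiSpivakovsky2014, Thm. 1.1 and Section 3.1] -/
theorem relLocalUniformization_of_rankOne_of_trdeg_le (k : Type) [Field k] (d : ℕ)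
    (hrank1 : ∀ (K : Type) [Field K] [Algebra k K], Algebra.trdeg k K ≤ d →
      ∀ O : ValuationSubring K, Nonempty O.valuation.RankOne → RelLocalUniformization k K O)
    (K : Type) [Field K] [Algebra k K] (hK : Algebra.trdeg k K ≤ d) (O : ValuationSubring K) :
    RelLocalUniformization k K O := by
  suffices main : ∀ (n : ℕ) (K : Type) [Field K] [Algebra k K], Algebra.trdeg k K ≤ d →
      ∀ (O : ValuationSubring K), Finite {S : ValuationSubring K // O ≤ S} →
      Nat.card {S : ValuationSubring K // O ≤ S} = n → RelLocalUniformization k K O by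
    intro R hR hfrac hRO
    have hk : ∀ c : k, algebraMap k K c ∈ O := fun c => hRO (R.algebraMap_mem c)
    haveI := hfrac
    have hfin := finite_overrings_of_fg O hk R hR
    exact main _ K hK O hfin rfl R hR hfrac hRO
  intro n
  induction n using Nat.strong_induction_on with
  | _ n ih => ?_
  intro K _ _ hK O hfin hn
  -- case analysis on the overrings of `O`
  by_cases htop : O = ⊤
  · subst htop; exact relLocalUniformization_top
  by_cases h2 : ∀ S : ValuationSubring K, O ≤ S → S = O ∨ S = ⊤
  · exact hrank1 K hK O (nonempty_rankOne_of_overrings O htop h2)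
  push Not at h2
  obtain ⟨O₁, hO, hne, hne_top⟩ := h2
  -- induction hypothesis for `ν₁` (same field)
  have ih₁ : RelLocalUniformization k K O₁ := by
    have hlt : Nat.card {S : ValuationSubring K // O₁ ≤ S} < n := by
      rw [← hn, ← ValuationSubring.ofPrime_idealOfLE O O₁ hO]
      exact card_overrings_ofPrime_lt O _ (idealOfLE_ne_maximalIdeal O O₁ hO hne)
    haveI : Finite {S : ValuationSubring K // O₁ ≤ S} := by
      rw [← ValuationSubring.ofPrime_idealOfLE O O₁ hO]; infer_instance
    exact ih _ hlt K hK O₁ this rfl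
  -- induction hypothesis for the restrictions of `ν₂` to fields of transcendence degree `≤ d`
  have ih₂ : ∀ (κ : Type) [Field κ] [Algebra k κ], Algebra.trdeg k κ ≤ d →
      ∀ (ι : κ →+* ResidueField O₁),
      RelLocalUniformization k κ ((residueValuationSubring O O₁ hO).comap ι) := by
    intro κ _ _ hκ ι
    have hlt2 := card_overrings_residue_lt O O₁ hO hne_top
    have hle := card_overrings_comap_le (residueValuationSubring O O₁ hO) ι
    exact ih _ (hn ▸ lt_of_le_of_lt hle hlt2) κ hκ _ inferInstance rfl
  -- the three steps
  intro R hR hfrac hRO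
  obtain ⟨A₁, hA₁, hRA₁, hA₁fg, hreg₁⟩ :=
    novacoskiSpivakovsky2014_cor214 O O₁ hO R hR hfrac hRO (ih₁ R hR hfrac (hRO.trans hO))
  haveI := hfrac
  haveI hfrac₁ : IsFractionRing A₁ K := isFractionRing_subalgebra_of_le R A₁ hRA₁
  -- the input of Cor. 2.17 from the induction hypothesis for `ν₂` on `κ = Frac φ(A₁)`,
  -- a field of transcendence degree `tr.deg_k φ(A₁) ≤ tr.deg_k A₁ = tr.deg_k K ≤ d`
  have ih₂' : ∀ (κ : Type) [Field κ] [Algebra k κ] (ι : κ →+* ResidueField O₁) (φ : A₁ →ₐ[k] κ),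
      (∀ a : A₁, ι (φ a) = residue O₁ ⟨(a : K), (hA₁.trans hO) a.2⟩) →
      IsFractionRing φ.range κ →
      ∃ (B : Subalgebra k κ)
        (hB : B.toSubring ≤ ((residueValuationSubring O O₁ hO).comap ι).toSubring),
        φ.range ≤ B ∧ B.FG ∧
        IsRegularLocalRing (Localization.AtPrime
          ((maximalIdeal ((residueValuationSubring O O₁ hO).comap ι)).comap
            (Subring.inclusion hB))) := by
    intro κ _ _ ι φ hφ hfr
    have hfg : φ.range.FG := by
      have h := ((Subalgebra.fg_top A₁).mpr hA₁fg).map φ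
      rwa [Algebra.map_top] at h
    have hle : φ.range.toSubring ≤ ((residueValuationSubring O O₁ hO).comap ι).toSubring := by
      intro z hz
      obtain ⟨a, rfl⟩ := (AlgHom.mem_range φ).mp (show z ∈ φ.range from hz)
      change φ a ∈ (residueValuationSubring O O₁ hO).comap ι
      rw [ValuationSubring.mem_comap, hφ]
      exact (residue_mem_residueValuationSubring_iff O O₁ hO _).mpr (hA₁ a.2)
    have hκ : Algebra.trdeg k κ ≤ d := by
      haveI := hfr
      rw [trdeg_eq_trdeg_of_isFractionRing φ.range]
      calc Algebra.trdeg k φ.range ≤ Algebra.trdeg k A₁ :=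
            trdeg_le_of_surjective φ.rangeRestrict φ.rangeRestrict_surjective
        _ = Algebra.trdeg k K := (trdeg_eq_trdeg_of_isFractionRing A₁).symm
        _ ≤ d := hK
    exact ih₂ κ hκ ι φ.range hfg hfr hle
  obtain ⟨A₂, hA₂, hA₁₂, hA₂fg, hreg₂, hreg₂'⟩ :=
    novacoskiSpivakovsky2014_cor217 O O₁ hO A₁ hA₁ hA₁fg hfrac₁ hreg₁ ih₂'
  haveI hfrac₂ : IsFractionRing A₂ K := isFractionRing_subalgebra_of_le A₁ A₂ hA₁₂
  obtain ⟨A₃, hA₃, hA₂₃, hA₃fg, hreg₃⟩ :=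
    novacoskiSpivakovsky2014_step O O₁ hO A₂ hA₂ hA₂fg hfrac₂ hreg₂ hreg₂'
  exact ⟨A₃, hA₃, hRA₁.trans (hA₁₂.trans hA₂₃), hA₃fg, hreg₃⟩

end Literature.AlgebraicGeometry.Resolution

end
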